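import Mathlib.Data.ZMod.Basic
import Mathlib.Tactic

/-!
# D-0122 AXIS B, knob k2 (LABEL SET), the `𝔽_l^{⋊±}` side — ORBIT TRICHOTOMY for the maps `x ↦ ±x + a` on `𝔽_l` (`l` prime): a finite set on
# which a composition-closed family of such maps acts stably and transitively has `≤ 2` or exactly `l` elements; so NO label set of size in
# `[3, l − 1]` — the truncations `{−L,…,L}` (`1 ≤ L ≤ l⋆ − 1`) and the parity subsets of `𝔽_l` — is the orbit of a subgroup of the `𝔽_l^{⋊±}`-symmetry

abc-iut cell, rung LADDER-ABC:A2.RESCUE.H. Statement and proof: abc-iut-reqb-rf-2 (GEN 2 scratch `ThetaPMOrbits.lean` sha16 f0fde0879c374b68, cited AS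
SCRATCH in the D-0121/D-0122 FINAL Part (II) (R/ROUND3/D0121-FINAL-1200Z.md c9ab8e0bbc43dc94, NEW-THEORY k2 clause (c): «on the F_l^⋊± side every
subgroup orbit in F_l has size 1, 2 or l (… reqb-rf-2 scratch ThetaPMOrbits.lean f0fde0879c374b68 rc 0 …)»); tree-shaped by GEN 4 as a post-letter
INPUT FILE for the k2 typer abc-iut-reqb-typ-2 / owner abc-iut-rh-lead — PROOF-ONLY (0 definitions: the affine maps are hypotheses `∀ x, f x = ε·x + a`,
`ε ∈ {1, −1}`), companion of `RHReqsideLabelsNoSymmetry` p513512 (the `𝔽_l^⋇` side of the truncation rows) and of the input file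
`RHReqsideLabelsParityNoSymmetry` (the `𝔽_l^⋇` side of the parity rows). NOT a letter condition.

THE ARITHMETIC ([IUTchI] Def. 6.1, Prop. 6.8 (i): the `𝔽_l^{⋊±} = 𝔽_l ⋊ {±1}`-symmetry acts on the labels `T ≅ 𝔽_l` through `x ↦ ±x + a`).
* `stable_under_translation_eq_univ`: a nonempty subset of `ZMod l` (`l` prime) stable under ONE non-trivial translation is everything
  (iterate the translation `((y − x₀)·a⁻¹).val` times).
* `affPM_orbit_card`: let `H` be a composition-closed family of maps of the form `x ↦ ε·x + a` (`ε = ±1`) and `S` a nonempty finite `H`-stable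
  set on which `H` acts transitively. If `H` contains a non-trivial translation, `S = ZMod l` (`|S| = l`); otherwise every element of `H` moving
  a base point `x₀ ∈ S` is a reflection `x ↦ −x + a`, and two reflections in `H` have the same `a` (their composite is the translation by
  `a − a′`, which must be trivial) — so `S ⊆ {x₀, a − x₀}`, `|S| ≤ 2`.
* `affPM_no_midsize_orbit`: hence `3 ≤ |S| ≤ l − 1` is impossible. The registered k2 label sets on the `𝔽_l^{⋊±}` side all fall in that window
  for the tabulated `l ≥ 7`: truncations `{−L,…,L}` have `|·| = 2L + 1 ∈ [3, l − 2]` for `1 ≤ L ≤ l⋆ − 1`; parity sets `{0} ∪ {±even}` /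
  `{±odd}` have `1 + 2·⌊l⋆/2⌋` / `2·⌈l⋆/2⌉ ∈ [3, l − 1]` elements (`RHReqsideLabelsParityNoSymmetry.parityLabelsPM_card_window`).
READING (the rf seats' CONSISTENCY column, recorded not adjudicated): the truncated / parity Θ±-label sets of REQB-TABLE v1 b8ac679ede5d795b inherit no
subgroup of the `𝔽_l^{⋊±}`-symmetry acting transitively on them — the `𝔽_l^{⋊±}` leg of the k2 words INCONSISTENT ⇒ NEW-THEORY (H); the conjugate
synchronisation of [IUTchI] Rmk. 6.12.4 / [IUTchII] Rmk. 4.5.3 is built from that transitive action (loci Q2-07, Q2-13 of LOCI-rf-2.tsv 6c7aff5d032053f6).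

HONEST FRAMING. Elementary group theory of `ZMod l`; «label», «symmetry», «orbit» are used in OUR typed currency; nothing here asserts that abc is
proved or refuted, that [IUTchIII] Cor. 3.12 / [IUTchIV] Thm. 1.10 holds or fails, or takes a side on any author; a parameter change of our functional
is not a claim that [IUTchI–III] admit it; typed ≠ proved; located ≠ adjudicated. [claim: Mochizuki2012, status: disputed] for the IUT locutions.
[folklore] for every statement below.
-/

namespace Summit.ABC.IUTFork.Repair.RH.ReqsideLabelsPlusMinusOrbits

open Finset

/-- **A nonempty finite subset of `ZMod l` (`l` prime) stable under a non-trivial translation `x ↦ x + a` is all of `ZMod l`.** [folklore] -/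
theorem stable_under_translation_eq_univ {l : ℕ} [hp : Fact l.Prime] (S : Finset (ZMod l)) {a : ZMod l} (ha : a ≠ 0)
    (hS : ∀ x ∈ S, x + a ∈ S) (hne : S.Nonempty) : S = univ := by
  obtain ⟨x₀, hx₀⟩ := hne
  have step : ∀ n : ℕ, x₀ + (n : ZMod l) * a ∈ S := by
    intro n
    induction n with
    | zero => simpa using hx₀
    | succ n ih =>
      have := hS _ ih
      simpa [Nat.cast_succ, add_mul, add_assoc] using this
  haveI : NeZero l := ⟨hp.out.ne_zero⟩
  ext y
  simp only [mem_univ, iff_true]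
  have key := step (((y - x₀) * a⁻¹).val)
  rwa [ZMod.natCast_zmod_val, mul_assoc, inv_mul_cancel₀ ha, mul_one, add_sub_cancel] at key

/-- **ORBIT TRICHOTOMY for the `x ↦ ±x + a` maps on `ZMod l`, `l` prime**: a composition-closed family `H` of such maps acting stably and
transitively on a nonempty finite set `S` has `|S| ≤ 2` or `|S| = l`. [folklore] -/
theorem affPM_orbit_card {l : ℕ} [hp : Fact l.Prime] (H : Set (ZMod l → ZMod l))
    (hH : ∀ f ∈ H, ∃ ε a : ZMod l, (ε = 1 ∨ ε = -1) ∧ ∀ x, f x = ε * x + a)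
    (hcomp : ∀ f ∈ H, ∀ g ∈ H, f ∘ g ∈ H)
    (S : Finset (ZMod l)) (hS : ∀ f ∈ H, ∀ x ∈ S, f x ∈ S)
    (htrans : ∀ x ∈ S, ∀ y ∈ S, ∃ f ∈ H, f x = y) (hne : S.Nonempty) :
    S.card ≤ 2 ∨ S.card = l := by
  by_cases htr : ∃ g ∈ H, ∃ a : ZMod l, a ≠ 0 ∧ ∀ x, g x = x + a
  · -- a non-trivial translation: S = univ
    obtain ⟨g, hg, a, ha, hga⟩ := htr
    right
    have hSu := stable_under_translation_eq_univ S ha (fun x hx => by simpa [hga] using hS g hg x hx) hne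
    rw [hSu, card_univ, ZMod.card]
  · -- only reflections (and the identity) move points: S ⊆ {x₀, y₁}
    left
    obtain ⟨x₀, hx₀⟩ := hne
    have uniq : ∀ y ∈ S, y ≠ x₀ → ∀ y' ∈ S, y' ≠ x₀ → y = y' := by
      intro y hy hyx y' hy' hy'x
      obtain ⟨f, hf, hfx⟩ := htrans x₀ hx₀ y hy
      obtain ⟨f', hf', hf'x⟩ := htrans x₀ hx₀ y' hy'
      obtain ⟨ε, a, hε, hfa⟩ := hH f hf
      obtain ⟨ε', a', hε', hfa'⟩ := hH f' hf'
      rcases hε with rfl | rfl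
      · have ha0 : a = 0 := by
          by_contra h
          exact htr ⟨f, hf, a, h, fun x => by rw [hfa]; ring⟩
        have : y = x₀ := by rw [← hfx, hfa, ha0]; ring
        exact absurd this hyx
      rcases hε' with rfl | rfl
      · have ha0 : a' = 0 := by
          by_contra h
          exact htr ⟨f', hf', a', h, fun x => by rw [hfa']; ring⟩
        have : y' = x₀ := by rw [← hf'x, hfa', ha0]; ring
        exact absurd this hy'x
      -- both reflections: their composite is the translation by a − a'
      have hc : f ∘ f' ∈ H := hcomp _ hf _ hf'
      have hcx : ∀ x, (f ∘ f') x = x + (a - a') := by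
        intro x
        show f (f' x) = x + (a - a')
        rw [hfa, hfa']; ring
      have haa : a - a' = 0 := by
        by_contra h
        exact htr ⟨f ∘ f', hc, a - a', h, hcx⟩
      have haeq : a = a' := sub_eq_zero.mp haa
      rw [← hfx, ← hf'x, hfa, hfa', haeq]
    by_cases hex : ∃ y ∈ S, y ≠ x₀
    · obtain ⟨y₁, hy₁, hy₁x⟩ := hex
      have hsub : S ⊆ {x₀, y₁} := by
        intro z hz
        by_cases hzx : z = x₀
        · simp [hzx]
        · have := uniq z hz hzx y₁ hy₁ hy₁x
          simp [this]
      calc S.card ≤ ({x₀, y₁} : Finset (ZMod l)).card := card_le_card hsub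
        _ ≤ 2 := card_insert_le _ _ |>.trans (by simp)
    · push Not at hex
      have hsub : S ⊆ {x₀} := by
        intro z hz; simp [hex z hz]
      calc S.card ≤ ({x₀} : Finset (ZMod l)).card := card_le_card hsub
        _ ≤ 2 := by simp

/-- **No mid-size orbit**: with `3 ≤ |S| < l` no such `H` exists. In particular the truncated Θ±-label set `{−L,…,L}`, `1 ≤ L ≤ l⋆ − 1`
(`|T_L| = 2L + 1 ∈ [3, l − 2]`), and the parity subsets of `𝔽_l` (sizes `1 + 2·⌊l⋆/2⌋`, `2·⌈l⋆/2⌉ ∈ [3, l − 1]` for `l ≥ 7`) are the orbit of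
NO subgroup of the `𝔽_l^{⋊±}`-symmetry. [folklore] -/
theorem affPM_no_midsize_orbit {l : ℕ} [Fact l.Prime] (H : Set (ZMod l → ZMod l))
    (hH : ∀ f ∈ H, ∃ ε a : ZMod l, (ε = 1 ∨ ε = -1) ∧ ∀ x, f x = ε * x + a)
    (hcomp : ∀ f ∈ H, ∀ g ∈ H, f ∘ g ∈ H)
    (S : Finset (ZMod l)) (hS : ∀ f ∈ H, ∀ x ∈ S, f x ∈ S)
    (htrans : ∀ x ∈ S, ∀ y ∈ S, ∃ f ∈ H, f x = y) (h3 : 3 ≤ S.card) (hl : S.card < l) : False := by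
  have hne : S.Nonempty := card_pos.mp (by omega)
  rcases affPM_orbit_card H hH hcomp S hS htrans hne with h | h <;> omega

/-- **The full symmetry is in scope of the trichotomy** (sanity record): the family of ALL maps `x ↦ ±x + a` is composition-closed, so the
hypotheses of `affPM_orbit_card` are met by the whole `𝔽_l^{⋊±}`-action and by every composition-closed subfamily (every subgroup). [folklore] -/
theorem affPM_family_comp_closed {l : ℕ} (f g : ZMod l → ZMod l)
    (hf : ∃ ε a : ZMod l, (ε = 1 ∨ ε = -1) ∧ ∀ x, f x = ε * x + a)
    (hg : ∃ ε a : ZMod l, (ε = 1 ∨ ε = -1) ∧ ∀ x, g x = ε * x + a) :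
    ∃ ε a : ZMod l, (ε = 1 ∨ ε = -1) ∧ ∀ x, (f ∘ g) x = ε * x + a := by
  obtain ⟨ε, a, hε, hfa⟩ := hf
  obtain ⟨ε', a', hε', hga⟩ := hg
  refine ⟨ε * ε', ε * a' + a, ?_, fun x => ?_⟩
  · rcases hε with rfl | rfl <;> rcases hε' with rfl | rfl <;> simp
  · show f (g x) = ε * ε' * x + (ε * a' + a)
    rw [hfa, hga]; ring

end Summit.ABC.IUTFork.Repair.RH.ReqsideLabelsPlusMinusOrbits
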